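import Literature.Topology.FourManifolds.WallHost
import Literature.Topology.FourManifolds.SegmentConj
import Literature.Topology.FourManifolds.BandSumIsotopyRegularProofs
import HarnessLib

/-!
# Segment conjugation frames for wall references

Topic `Literature/Topology/FourManifolds` (trunk T-4MAN). Fact seat
`provefact-Literature.Topology.FourManifolds.Knot.IsConnectedSum.isIsotopic` (Schubert's theorem),
geometric heart for rail knots. The generic form of the loop frames of the segment conjugations
(`SegmentConj.SegData.Frame`): for a wall reference `W` of `b` (`WallHost.lean`), segment data
`D` whose source segment is the straight host segment `o + [-1, 1/2] d` of `b` (`D.o = W.segO`,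
`D.d = W.segD`) and whose ambient isotopy carries the reference host `W.host` onto a target knot
`Htgt` point for point, and a far radius `R₁` for `Htgt`, the bent knot `W.bent` at a small unit
scale (`UnitScale`) is framed for `D` (`frameOne`): window parameters by the intermediate value
theorem on the ray scalars, the collar / inner / off-window properties from the pointwise
description of the bent knots and of the reference host (`WallHost.lean`). Output: the knot
`outOne` with `W.bent ≃ outOne` (`isIsotopic_bent_outOne`) and its pointwise description, and the
thresholds (`exists_thresholds`).

Everything is proved; no named facts are introduced.

## References

* M. W. Hirsch, *Differential Topology*, GTM 33 (1976), Ch. 8 §1, Thm. 1.3. [HirschDT1976]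
-/

open scoped Manifold ContDiff Topology Real
open Function Set Metric Filter

noncomputable section

namespace Literature.Topology.FourManifolds

/-- Local notation: `𝔼 n` is the model Euclidean space `EuclideanSpace ℝ (Fin n)`. -/
local notation "𝔼 " n:arg => EuclideanSpace ℝ (Fin n)

/-- Local notation: `𝕊 n` is the unit sphere in `EuclideanSpace ℝ (Fin (n + 1))`. -/
local notation "𝕊 " n:arg => (Metric.sphere (0 : EuclideanSpace ℝ (Fin (n + 1))) 1)

attribute [local instance] fact_finrank_euclideanSpace_succ

open KnotsInBall ExitBend SegmentConj

namespace BandData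


namespace WallRef

variable {A B K : Knot} {b : BandData A B K ∅}
  {hcross : b.band ⁻¹' sphereEquator 2 ∩ squareNhd b.δ = {x ∈ squareNhd b.δ | x 0 = 2⁻¹}}
  {ε r A' κ : ℝ} {F : ℝ → 𝔼 4} (W : b.WallRef hcross ε r A' κ F)
  {lam₀ rA : ℝ} (hl₀ : lam₀ ∈ Ioc (0 : ℝ) 1) (hl₀2 : lam₀ ≤ 1 / 2) (hrA : 0 < rA) (hrA8 : rA ≤ 1 / 8)

/-! ### The unit scale -/

/-- **Smallness of the actual unit scale** `λ₀` and bend radius `r_A` against the window clock `ρ₂`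
and the unit radius `R₀` of the segment data. [folklore] -/
structure UnitScale (W : b.WallRef hcross ε r A' κ F) (ρ₂ R₀ lam₀ rA : ℝ) : Prop where
  hl₀ : lam₀ ∈ Ioc (0 : ℝ) 1
  hl₀2 : lam₀ ≤ 1 / 2
  hrA : 0 < rA
  hrA8 : rA ≤ 1 / 8
  rA_le : 4 * rA ≤ ρ₂
  arc_le : κ * ‖((b.frame hcross : (𝔼 3) ≃L[ℝ] 𝔼 3) : (𝔼 3) →L[ℝ] 𝔼 3)‖ * (2 * rA * (‖dLo b.depthSign‖ + ‖dHi b.depthSign‖)) ≤ R₀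
  small : lam₀ * (9 + 4 * ‖(((b.frame hcross).symm : (𝔼 3) ≃L[ℝ] 𝔼 3) : (𝔼 3) →L[ℝ] 𝔼 3)‖ / κ) ≤ rA
  gen_le : lam₀ * (κ * ‖((b.frame hcross : (𝔼 3) ≃L[ℝ] 𝔼 3) : (𝔼 3) →L[ℝ] 𝔼 3)‖ *
    (9 + 4 * ‖(((b.frame hcross).symm : (𝔼 3) ≃L[ℝ] 𝔼 3) : (𝔼 3) →L[ℝ] 𝔼 3)‖ / κ)) ≤ R₀
  lam_lt : lam₀ < ρ₂

omit hl₀ in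
/-- **Existence of unit scales** for every positive window clock `ρ₂ ≤ 1/4` and unit radius `R₀`.
[folklore] -/
theorem exists_unitScale {ρ₂ R₀ : ℝ} (hρ : 0 < ρ₂) (hR : 0 < R₀) : ∃ lam₀ rA, W.UnitScale ρ₂ R₀ lam₀ rA := by
  have hκ := W.HU.cone.spike.κ_pos
  set NF := ‖((b.frame hcross : (𝔼 3) ≃L[ℝ] 𝔼 3) : (𝔼 3) →L[ℝ] 𝔼 3)‖ with hNF
  set N' := ‖(((b.frame hcross).symm : (𝔼 3) ≃L[ℝ] 𝔼 3) : (𝔼 3) →L[ℝ] 𝔼 3)‖ with hN'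
  have hNF0 : 0 ≤ NF := norm_nonneg _
  have hN'0 : 0 ≤ N' := norm_nonneg _
  set D := ‖dLo b.depthSign‖ + ‖dHi b.depthSign‖ with hD
  have hD0 : 0 ≤ D := by positivity
  set C := 9 + 4 * N' / κ with hC
  have hC0 : 0 < C := by positivity
  -- the bend radius
  set rA := min (1 / 8) (min (ρ₂ / 4) (R₀ / (κ * NF * (2 * D) + 1))) with hrAdef
  have hden : 0 < κ * NF * (2 * D) + 1 := by positivity
  have hrApos : 0 < rA := lt_min (by norm_num) (lt_min (by positivity) (div_pos hR hden))
  have hrA1 : rA ≤ 1 / 8 := min_le_left _ _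
  have hrA2 : rA ≤ ρ₂ / 4 := (min_le_right _ _).trans (min_le_left _ _)
  have hrA3 : rA ≤ R₀ / (κ * NF * (2 * D) + 1) := (min_le_right _ _).trans (min_le_right _ _)
  -- the unit scale
  set lam₀ := min (1 / 2) (min (rA / C) (min (R₀ / (κ * NF * C + 1)) (ρ₂ / 2))) with hlamdef
  have hden2 : 0 < κ * NF * C + 1 := by positivity
  have hlpos : 0 < lam₀ := lt_min (by norm_num) (lt_min (div_pos hrApos hC0) (lt_min (div_pos hR hden2) (by positivity)))
  have hl1 : lam₀ ≤ 1 / 2 := min_le_left _ _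
  have hl2 : lam₀ ≤ rA / C := (min_le_right _ _).trans (min_le_left _ _)
  have hl3 : lam₀ ≤ R₀ / (κ * NF * C + 1) := (min_le_right _ _).trans ((min_le_right _ _).trans (min_le_left _ _))
  have hl4 : lam₀ ≤ ρ₂ / 2 := (min_le_right _ _).trans ((min_le_right _ _).trans (min_le_right _ _))
  refine ⟨lam₀, rA, ⟨⟨hlpos, by linarith⟩, hl1, hrApos, hrA1, by linarith, ?_, ?_, ?_, by linarith⟩⟩
  · rw [le_div_iff₀ hden] at hrA3
    have : κ * NF * (2 * rA * D) = rA * (κ * NF * (2 * D)) := by ring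
    rw [this]; nlinarith [mul_nonneg (mul_nonneg hκ.le hNF0) hD0]
  · rw [le_div_iff₀ hC0] at hl2; linarith
  · rw [le_div_iff₀ hden2] at hl3
    nlinarith [mul_nonneg (mul_nonneg hκ.le hNF0) hC0.le]

/-! ### Window parameters at the actual scale -/

/-- The level `3/4` lies in `[-7, 7]`. [folklore] -/
theorem three_quarters_mem7 : (3 / 4 : ℝ) ∈ Icc (-7 : ℝ) 7 := ⟨by norm_num, by norm_num⟩

/-- The lower end of the general content: level `3/4` on the lower core. [folklore] -/
def lowEnd (W : b.WallRef hcross ε r A' κ F) : ℝ := b.parLo W.HU.cone.spike.κ_pos W.HU.cone.spike.seven_le_gapLo three_quarters_mem7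

/-- The upper end of the general content: level `3/4` on the upper core. [folklore] -/
def upEnd (W : b.WallRef hcross ε r A' κ F) : ℝ := b.parHi W.HU.cone.spike.κ_pos W.HU.cone.spike.seven_le_gapHi three_quarters_mem7

/-- **Marks of the content zones**: `juncLo < lowEnd`, `upEnd < juncHi`, cores. [folklore] -/
theorem content_marks : b.juncLo W.HU.cone.spike.κ_pos W.HU.cone.spike.seven_le_gapLo < W.lowEnd ∧ W.lowEnd ≤ b.tcLo + b.epsLo / 8 ∧
    b.tcHi - b.epsHi / 8 ≤ W.upEnd ∧ W.upEnd < b.juncHi W.HU.cone.spike.κ_pos W.HU.cone.spike.seven_le_gapHi ∧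
    b.tcLo ≤ b.juncLo W.HU.cone.spike.κ_pos W.HU.cone.spike.seven_le_gapLo ∧
    b.juncHi W.HU.cone.spike.κ_pos W.HU.cone.spike.seven_le_gapHi ≤ b.tcHi := by
  have h := W.HU.cone.spike
  have hκ := h.κ_pos
  obtain ⟨hjl, hjlv⟩ := b.juncLo_spec hκ h.seven_le_gapLo
  obtain ⟨hjh, hjhv⟩ := b.juncHi_spec hκ h.seven_le_gapHi
  have c1 := b.parLo_mem_core hκ h.seven_le_gapLo three_quarters_mem7
  have c2 := b.parHi_mem_core hκ h.seven_le_gapHi three_quarters_mem7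
  have hε := b.epsLo_bounds.1
  have hε' := b.epsHi_bounds.1
  refine ⟨?_, c1.2, c2.1, ?_, hjl.1, hjh.2⟩
  · exact (b.alphaLo_lt_iff' hκ h.seven_le_gapLo three_quarters_mem7 ⟨by linarith [hjl.1], hjl.2⟩).1 (by rw [hjlv]; norm_num)
  · exact (b.alphaHi_lt_iff' hκ h.seven_le_gapHi three_quarters_mem7 ⟨hjh.1, by linarith [hjh.2]⟩).1 (by rw [hjhv]; norm_num)

/-- **Existence of lower window parameters**: every `v ∈ [λ₀/3, 5/6]` is the lower ray scalar of a
parameter of `[juncLo, lowEnd]`. [folklore] -/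
theorem exists_lowPar {v : ℝ} (hv : v ∈ Icc (lam₀ / 3) (5 / 6)) :
    ∃ s ∈ Icc (b.juncLo W.HU.cone.spike.κ_pos W.HU.cone.spike.seven_le_gapLo) W.lowEnd, b.psiLo κ lam₀ s = v := by
  have h := W.HU.cone.spike
  have hκ := h.κ_pos
  obtain ⟨m1, m2, m3, m4, m5, m6⟩ := W.content_marks
  obtain ⟨hjl, hjlv⟩ := b.juncLo_spec hκ h.seven_le_gapLo
  have v1 : b.psiLo κ lam₀ (b.juncLo hκ h.seven_le_gapLo) = 5 / 6 := by simp only [psiLo, hjlv, spikeScalar_three_eighths]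
  have v2 : b.psiLo κ lam₀ W.lowEnd = lam₀ / 3 := by
    simp only [psiLo, lowEnd, b.alphaLo_parLo hκ h.seven_le_gapLo three_quarters_mem7, spikeScalar_three_quarters]; ring
  have hcont := (b.contDiff_psiLo κ lam₀).continuous.continuousOn (s := Icc (b.juncLo hκ h.seven_le_gapLo) W.lowEnd)
  exact intermediate_value_Icc' m1.le hcont (by rw [v1, v2]; exact ⟨hv.1, hv.2⟩)

/-- **Existence of upper window parameters**: every `v ∈ [λ₀/3, 5/6]` is the upper ray scalar of a
parameter of `[upEnd, juncHi]`. [folklore] -/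
theorem exists_upPar {v : ℝ} (hv : v ∈ Icc (lam₀ / 3) (5 / 6)) :
    ∃ s ∈ Icc W.upEnd (b.juncHi W.HU.cone.spike.κ_pos W.HU.cone.spike.seven_le_gapHi), b.psiHi κ lam₀ s = v := by
  have h := W.HU.cone.spike
  have hκ := h.κ_pos
  obtain ⟨m1, m2, m3, m4, m5, m6⟩ := W.content_marks
  obtain ⟨hjh, hjhv⟩ := b.juncHi_spec hκ h.seven_le_gapHi
  have v1 : b.psiHi κ lam₀ (b.juncHi hκ h.seven_le_gapHi) = 5 / 6 := by simp only [psiHi, hjhv, spikeScalar_three_eighths]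
  have v2 : b.psiHi κ lam₀ W.upEnd = lam₀ / 3 := by
    simp only [psiHi, upEnd, b.alphaHi_parHi hκ h.seven_le_gapHi three_quarters_mem7, spikeScalar_three_quarters]; ring
  have hcont := (b.contDiff_psiHi κ lam₀).continuous.continuousOn (s := Icc W.upEnd (b.juncHi hκ h.seven_le_gapHi))
  exact intermediate_value_Icc m4.le hcont (by rw [v1, v2]; exact ⟨hv.1, hv.2⟩)

/-- **The lower window parameter** of ray scalar `v`. [folklore] -/
def lowPar {v : ℝ} (hv : v ∈ Icc (lam₀ / 3) (5 / 6)) : ℝ := (W.exists_lowPar hv).choose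

/-- The lower window parameter lies in `[juncLo, lowEnd]` and has ray scalar `v`. [folklore] -/
theorem lowPar_spec {v : ℝ} (hv : v ∈ Icc (lam₀ / 3) (5 / 6)) :
    W.lowPar hv ∈ Icc (b.juncLo W.HU.cone.spike.κ_pos W.HU.cone.spike.seven_le_gapLo) W.lowEnd ∧ b.psiLo κ lam₀ (W.lowPar hv) = v :=
  (W.exists_lowPar hv).choose_spec

/-- **The upper window parameter** of ray scalar `v`. [folklore] -/
def upPar {v : ℝ} (hv : v ∈ Icc (lam₀ / 3) (5 / 6)) : ℝ := (W.exists_upPar hv).choose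

/-- The upper window parameter lies in `[upEnd, juncHi]` and has ray scalar `v`. [folklore] -/
theorem upPar_spec {v : ℝ} (hv : v ∈ Icc (lam₀ / 3) (5 / 6)) :
    W.upPar hv ∈ Icc W.upEnd (b.juncHi W.HU.cone.spike.κ_pos W.HU.cone.spike.seven_le_gapHi) ∧ b.psiHi κ lam₀ (W.upPar hv) = v :=
  (W.exists_upPar hv).choose_spec

/-- Lower window parameters lie in the lower core with `αLo ∈ [3/8, 3/4]`. [folklore] -/
theorem lowPar_core {v : ℝ} (hv : v ∈ Icc (lam₀ / 3) (5 / 6)) :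
    W.lowPar hv ∈ Icc (b.tcLo - b.epsLo / 8) (b.tcLo + b.epsLo / 8) ∧ b.alphaLo κ (W.lowPar hv) ∈ Icc (3 / 8 : ℝ) (3 / 4) := by
  have h := W.HU.cone.spike
  have hκ := h.κ_pos
  obtain ⟨m1, m2, m3, m4, m5, m6⟩ := W.content_marks
  obtain ⟨hs, -⟩ := W.lowPar_spec hv
  obtain ⟨hjl, hjlv⟩ := b.juncLo_spec hκ h.seven_le_gapLo
  have hε := b.epsLo_bounds.1
  have hs1 : b.juncLo W.HU.cone.spike.κ_pos W.HU.cone.spike.seven_le_gapLo ≤ W.lowPar hv := hs.1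
  have hs2 : W.lowPar hv ≤ W.lowEnd := hs.2
  have hcore : W.lowPar hv ∈ Icc (b.tcLo - b.epsLo / 8) (b.tcLo + b.epsLo / 8) := ⟨by linarith, by linarith⟩
  refine ⟨hcore, ?_, ?_⟩
  · rw [← hjlv]; exact (b.strictMonoOn_alphaLo hκ).monotoneOn ⟨by linarith [hjl.1], hjl.2⟩ hcore hs.1
  · rw [← b.alphaLo_parLo hκ h.seven_le_gapLo three_quarters_mem7]
    exact (b.strictMonoOn_alphaLo hκ).monotoneOn hcore (b.parLo_mem_core hκ h.seven_le_gapLo three_quarters_mem7) hs.2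

/-- Upper window parameters lie in the upper core with `αHi ∈ [3/8, 3/4]`. [folklore] -/
theorem upPar_core {v : ℝ} (hv : v ∈ Icc (lam₀ / 3) (5 / 6)) :
    W.upPar hv ∈ Icc (b.tcHi - b.epsHi / 8) (b.tcHi + b.epsHi / 8) ∧ b.alphaHi κ (W.upPar hv) ∈ Icc (3 / 8 : ℝ) (3 / 4) := by
  have h := W.HU.cone.spike
  have hκ := h.κ_pos
  obtain ⟨m1, m2, m3, m4, m5, m6⟩ := W.content_marks
  obtain ⟨hs, -⟩ := W.upPar_spec hv
  obtain ⟨hjh, hjhv⟩ := b.juncHi_spec hκ h.seven_le_gapHi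
  have hε := b.epsHi_bounds.1
  have hs1 : W.upEnd ≤ W.upPar hv := hs.1
  have hs2 : W.upPar hv ≤ b.juncHi W.HU.cone.spike.κ_pos W.HU.cone.spike.seven_le_gapHi := hs.2
  have hcore : W.upPar hv ∈ Icc (b.tcHi - b.epsHi / 8) (b.tcHi + b.epsHi / 8) := ⟨by linarith, by linarith⟩
  refine ⟨hcore, ?_, ?_⟩
  · rw [← hjhv]; exact (b.strictAntiOn_alphaHi hκ).antitoneOn hcore ⟨hjh.1, by linarith [hjh.2]⟩ hs.2
  · rw [← b.alphaHi_parHi hκ h.seven_le_gapHi three_quarters_mem7]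
    exact (b.strictAntiOn_alphaHi hκ).antitoneOn (b.parHi_mem_core hκ h.seven_le_gapHi three_quarters_mem7) hcore hs.1

include hl₀ in
/-- **Lower window parameters are ordered against the ray scalar** (`v < v'` gives `lowPar v' < lowPar v`).
[folklore] -/
theorem lowPar_lt_lowPar {v v' : ℝ} (hv : v ∈ Icc (lam₀ / 3) (5 / 6)) (hv' : v' ∈ Icc (lam₀ / 3) (5 / 6)) (hvv : v < v') :
    W.lowPar hv' < W.lowPar hv := by
  have hκ := W.HU.cone.spike.κ_pos
  obtain ⟨c1, a1⟩ := W.lowPar_core hv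
  obtain ⟨c2, a2⟩ := W.lowPar_core hv'
  have e1 := (W.lowPar_spec hv).2
  have e2 := (W.lowPar_spec hv').2
  by_contra hle; push Not at hle
  rcases hle.eq_or_lt with h | h
  · rw [h] at e1; linarith
  · have := psiLo_lt_psiLo_of_lt hl₀ hκ c1 c2 h (by linarith [a2.2])
    linarith

include hl₀ in
/-- **Upper window parameters are ordered with the ray scalar** (`v < v'` gives `upPar v < upPar v'`).
[folklore] -/
theorem upPar_lt_upPar {v v' : ℝ} (hv : v ∈ Icc (lam₀ / 3) (5 / 6)) (hv' : v' ∈ Icc (lam₀ / 3) (5 / 6)) (hvv : v < v') :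
    W.upPar hv < W.upPar hv' := by
  have hκ := W.HU.cone.spike.κ_pos
  obtain ⟨c1, a1⟩ := W.upPar_core hv
  obtain ⟨c2, a2⟩ := W.upPar_core hv'
  have e1 := (W.upPar_spec hv).2
  have e2 := (W.upPar_spec hv').2
  by_contra hle; push Not at hle
  rcases hle.eq_or_lt with h | h
  · rw [h] at e2; linarith
  · have := psiHi_lt_psiHi_of_lt hl₀ hκ c2 c1 h (by linarith [a2.2])
    linarith


end WallRef

/-! ### The frame of a segment conjugation -/

section FrameOne

variable {A B K : Knot} {b : BandData A B K ∅}
  {hcross : b.band ⁻¹' sphereEquator 2 ∩ squareNhd b.δ = {x ∈ squareNhd b.δ | x 0 = 2⁻¹}}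
  {ε r A' κ : ℝ} {F : ℝ → 𝔼 4} {W : b.WallRef hcross ε r A' κ F}
  -- the segment data: source segment = the straight host segment of `b`, end stage carries the
  -- reference host onto the target knot
  (D : SegData) (hDo : D.o = W.segO) (hDd : D.d = W.segD) (hDlo : D.ρlo = -1) (hDhi : D.ρhi = 1 / 2)
  {Htgt : Knot} (hΨ : ∀ x, stageOne D.Ψ (W.host x) = Htgt x)
  {ρ₂ R₀ lam₀ rA : ℝ} (U : W.UnitScale ρ₂ R₀ lam₀ rA) (hρ4 : ρ₂ ≤ 1 / 4)

namespace WallRef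

namespace UnitScale


include U in
/-- The window clock is positive. [folklore] -/
theorem ρ₂_pos : 0 < ρ₂ := U.hl₀.1.trans U.lam_lt

include U hρ4 in
/-- The window clock is an admissible ray scalar. [folklore] -/
theorem mem_two : ρ₂ ∈ Icc (lam₀ / 3) (5 / 6) := ⟨by linarith [U.lam_lt, U.hl₀.1], by linarith⟩

include U hρ4 in
/-- Half the window clock is an admissible ray scalar. [folklore] -/
theorem mem_one : ρ₂ / 2 ∈ Icc (lam₀ / 3) (5 / 6) := ⟨by linarith [U.lam_lt, U.hl₀.1], by linarith⟩

/-- **The window start** `w₁`: lower ray scalar `ρ₂` (clock `-ρ₂`). [folklore] -/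
def w₁ : ℝ := W.lowPar (U.mem_two hρ4)

/-- **The lower collar end** `c₁`: lower ray scalar `ρ₂/2`. [folklore] -/
def c₁ : ℝ := W.lowPar (U.mem_one hρ4)

/-- **The upper collar start** `c₂`: upper ray scalar `ρ₂/2`. [folklore] -/
def c₂ : ℝ := W.upPar (U.mem_one hρ4)

/-- **The window end** `w₂`: upper ray scalar `ρ₂`. [folklore] -/
def w₂ : ℝ := W.upPar (U.mem_two hρ4)

/-- **Marks of the window**: `alo < tcLo ≤ juncLo ≤ w₁ < c₁ ≤ lowEnd`, `upEnd ≤ c₂ < w₂ ≤ juncHi ≤ tcHi`. [folklore] -/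
theorem window_marks : b.juncLo W.HU.cone.spike.κ_pos W.HU.cone.spike.seven_le_gapLo ≤ U.w₁ hρ4 ∧ U.w₁ hρ4 < U.c₁ hρ4 ∧
    U.c₁ hρ4 ≤ W.lowEnd ∧ W.upEnd ≤ U.c₂ hρ4 ∧ U.c₂ hρ4 < U.w₂ hρ4 ∧
    U.w₂ hρ4 ≤ b.juncHi W.HU.cone.spike.κ_pos W.HU.cone.spike.seven_le_gapHi := by
  have hρ := U.ρ₂_pos
  refine ⟨(W.lowPar_spec (U.mem_two hρ4)).1.1, W.lowPar_lt_lowPar U.hl₀ (U.mem_one hρ4) (U.mem_two hρ4) (by linarith),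
    (W.lowPar_spec (U.mem_one hρ4)).1.2, (W.upPar_spec (U.mem_one hρ4)).1.1,
    W.upPar_lt_upPar U.hl₀ (U.mem_one hρ4) (U.mem_two hρ4) (by linarith), (W.upPar_spec (U.mem_two hρ4)).1.2⟩

/-- **THE COLLAR PROPERTY**: on the collars the bent knot runs along the segment with clock in
`[-ρ₂, ρ₂]`. [folklore] -/
theorem collar {s : ℝ} (hs : s ∈ Icc (U.w₁ hρ4) (U.c₁ hρ4) ∪ Icc (U.c₂ hρ4) (U.w₂ hρ4)) :
    ∃ ρ ∈ Icc (-ρ₂) ρ₂, Knot.curve (W.bent U.hl₀ U.hrA) s = ((psiN.symm (W.segO + ρ • W.segD) : 𝕊 3) : 𝔼 4) := by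
  have hκ := W.HU.cone.spike.κ_pos
  have hρ := U.ρ₂_pos
  obtain ⟨m1, m2, m3, m4, m5, m6⟩ := U.window_marks hρ4
  obtain ⟨z1, z2, z3, z4, z5, z6⟩ := W.content_marks
  obtain ⟨cw₁, aw₁⟩ := W.lowPar_core (U.mem_two hρ4)
  obtain ⟨cc₁, ac₁⟩ := W.lowPar_core (U.mem_one hρ4)
  obtain ⟨cc₂, ac₂⟩ := W.upPar_core (U.mem_one hρ4)
  obtain ⟨cw₂, aw₂⟩ := W.upPar_core (U.mem_two hρ4)
  have vw₁ := (W.lowPar_spec (U.mem_two hρ4)).2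
  have vc₁ := (W.lowPar_spec (U.mem_one hρ4)).2
  have vc₂ := (W.upPar_spec (U.mem_one hρ4)).2
  have vw₂ := (W.upPar_spec (U.mem_two hρ4)).2
  rw [Knot.curve_apply]
  simp only [w₁, c₁, c₂, w₂] at hs
  rcases hs with hs | hs
  · -- lower collar
    have hcore : s ∈ Icc (b.tcLo - b.epsLo / 8) (b.tcLo + b.epsLo / 8) := ⟨by linarith [hs.1, cw₁.1], by linarith [hs.2, cc₁.2]⟩
    have hα : b.alphaLo κ s ∈ Icc (1 / 4 : ℝ) (3 / 4) :=
      ⟨by linarith [aw₁.1, (b.strictMonoOn_alphaLo hκ).monotoneOn cw₁ hcore hs.1],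
        (((b.strictMonoOn_alphaLo hκ).monotoneOn hcore cc₁ hs.2)).trans ac₁.2⟩
    refine ⟨-b.psiLo κ lam₀ s, ⟨?_, ?_⟩, by rw [W.bent_lowerStraight U.hl₀ U.hrA hcore hα]⟩
    · -- `psiLo s ≤ psiLo w₁ = ρ₂`
      rcases hs.1.eq_or_lt with h | h
      · rw [← h, vw₁]
      · have := psiLo_lt_psiLo_of_lt U.hl₀ hκ cw₁ hcore h (by linarith [hα.2]); linarith
    · rcases hs.2.eq_or_lt with h | h
      · rw [h, vc₁]; linarith
      · have := psiLo_lt_psiLo_of_lt U.hl₀ hκ hcore cc₁ h (by linarith [ac₁.2]); linarith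
  · -- upper collar
    have hcore : s ∈ Icc (b.tcHi - b.epsHi / 8) (b.tcHi + b.epsHi / 8) := ⟨by linarith [hs.1, cc₂.1], by linarith [hs.2, cw₂.2]⟩
    have hα : b.alphaHi κ s ∈ Icc (3 / 8 : ℝ) (3 / 4) :=
      ⟨by linarith [aw₂.1, (b.strictAntiOn_alphaHi hκ).antitoneOn hcore cw₂ hs.2],
        ((b.strictAntiOn_alphaHi hκ).antitoneOn cc₂ hcore hs.1).trans ac₂.2⟩
    have hψ1 : ρ₂ / 2 ≤ b.psiHi κ lam₀ s := by
      rcases hs.1.eq_or_lt with h | h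
      · rw [← h, vc₂]
      · have := psiHi_lt_psiHi_of_lt U.hl₀ hκ cc₂ hcore h (by linarith [ac₂.2]); linarith
    have hψ2 : b.psiHi κ lam₀ s ≤ ρ₂ := by
      rcases hs.2.eq_or_lt with h | h
      · rw [h, vw₂]
      · have := psiHi_lt_psiHi_of_lt U.hl₀ hκ hcore cw₂ h (by linarith [hα.2]); linarith
    refine ⟨b.psiHi κ lam₀ s, ⟨by linarith, hψ2⟩, ?_⟩
    rw [W.bent_upperStraight U.hl₀ U.hrA U.hrA8 hcore hα ⟨by linarith [U.rA_le], by linarith⟩]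

/-- **THE INNER PROPERTY**: on the window the bent knot is a segment point with clock in `[-ρ₂, ρ₂]`
or a chart point within `R₀` of the centre. [folklore] -/
theorem inner {s : ℝ} (hs : s ∈ Icc (U.w₁ hρ4) (U.w₂ hρ4)) :
    (∃ ρ ∈ Icc (-ρ₂) ρ₂, Knot.curve (W.bent U.hl₀ U.hrA) s = ((psiN.symm (W.segO + ρ • W.segD) : 𝕊 3) : 𝔼 4)) ∨
      ∃ y ∈ closedBall (W.segO) R₀, Knot.curve (W.bent U.hl₀ U.hrA) s = ((psiN.symm y : 𝕊 3) : 𝔼 4) := by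
  have h := W.HU.cone.spike
  have hκ := h.κ_pos
  have hρ := U.ρ₂_pos
  obtain ⟨m1, m2, m3, m4, m5, m6⟩ := U.window_marks hρ4
  obtain ⟨z1, z2, z3, z4, z5, z6⟩ := W.content_marks
  obtain ⟨cw₁, aw₁⟩ := W.lowPar_core (U.mem_two hρ4)
  obtain ⟨cw₂, aw₂⟩ := W.upPar_core (U.mem_two hρ4)
  have vw₁ := (W.lowPar_spec (U.mem_two hρ4)).2
  have vw₂ := (W.upPar_spec (U.mem_two hρ4)).2
  have hcc := b.coreLo_lt_coreHi
  have hNF : 0 ≤ ‖((b.frame hcross : (𝔼 3) ≃L[ℝ] 𝔼 3) : (𝔼 3) →L[ℝ] 𝔼 3)‖ := norm_nonneg _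
  rw [Knot.curve_apply]
  simp only [w₁, w₂] at hs
  rcases le_or_gt s W.lowEnd with h1 | h1
  · -- lower ray: segment point with clock in `[-ρ₂, -λ₀/3]`
    left
    have hcore : s ∈ Icc (b.tcLo - b.epsLo / 8) (b.tcLo + b.epsLo / 8) := ⟨by linarith [hs.1, cw₁.1], by linarith⟩
    have hα : b.alphaLo κ s ∈ Icc (3 / 8 : ℝ) (3 / 4) :=
      ⟨aw₁.1.trans ((b.strictMonoOn_alphaLo hκ).monotoneOn cw₁ hcore hs.1), by
        rw [← b.alphaLo_parLo hκ h.seven_le_gapLo three_quarters_mem7]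
        exact (b.strictMonoOn_alphaLo hκ).monotoneOn hcore (b.parLo_mem_core hκ h.seven_le_gapLo three_quarters_mem7) h1⟩
    have hψ := psiLo_mem_of_alphaLo U.hl₀ hα
    refine ⟨-b.psiLo κ lam₀ s, ⟨?_, by linarith [hψ.1, U.hl₀.1]⟩,
      by rw [W.bent_lowerStraight U.hl₀ U.hrA hcore ⟨by linarith [hα.1], hα.2⟩]⟩
    rcases hs.1.eq_or_lt with h3 | h3
    · rw [← h3, vw₁]
    · have := psiLo_lt_psiLo_of_lt U.hl₀ hκ cw₁ hcore h3 (by linarith [hα.2]); linarith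
  rcases lt_or_ge s W.upEnd with h2 | h2
  · -- general content: the shrunk unit, within `R₀`
    right
    have hsc : s ∈ b.contentSet hκ h.seven_le_gapLo h.seven_le_gapHi := ⟨by linarith [hs.1], by linarith [hs.2]⟩
    have hαL : 3 / 4 < b.alphaLo κ s := by
      rcases le_or_gt s (b.tcLo + b.epsLo / 8) with h3 | h3
      · exact (b.lt_alphaLo_iff' hκ h.seven_le_gapLo three_quarters_mem7 ⟨by linarith [hs.1, cw₁.1], h3⟩).2 h1
      · have h77 := b.parLo_lt_parLo hκ h.seven_le_gapLo three_quarters_mem7 (⟨by norm_num, by norm_num⟩ : (7 : ℝ) ∈ Icc (-7 : ℝ) 7) (by norm_num)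
        have hc7 := b.parLo_mem_core hκ h.seven_le_gapLo (⟨by norm_num, by norm_num⟩ : (7 : ℝ) ∈ Icc (-7 : ℝ) 7)
        have h4 : 3 / 4 < b.alphaLo κ (b.tcLo + b.epsLo / 8) :=
          (b.lt_alphaLo_iff' hκ h.seven_le_gapLo three_quarters_mem7 ⟨by linarith [b.epsLo_bounds.1], le_rfl⟩).2 (by
            have : W.lowEnd = b.parLo hκ h.seven_le_gapLo three_quarters_mem7 := rfl
            linarith [hc7.2])
        exact h4.trans_le (b.alphaLo_monotone' hκ h3.le)
    have hαH : 3 / 4 < b.alphaHi κ s := by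
      rcases le_or_gt (b.tcHi - b.epsHi / 8) s with h3 | h3
      · exact (b.lt_alphaHi_iff' hκ h.seven_le_gapHi three_quarters_mem7 ⟨h3, by linarith [hs.2, cw₂.2]⟩).2 h2
      · have hc7 := b.parHi_mem_core hκ h.seven_le_gapHi (⟨by norm_num, by norm_num⟩ : (7 : ℝ) ∈ Icc (-7 : ℝ) 7)
        have h77 := b.parHi_lt_parHi hκ h.seven_le_gapHi three_quarters_mem7 (⟨by norm_num, by norm_num⟩ : (7 : ℝ) ∈ Icc (-7 : ℝ) 7) (by norm_num)
        have h4 : 3 / 4 < b.alphaHi κ (b.tcHi - b.epsHi / 8) :=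
          (b.lt_alphaHi_iff' hκ h.seven_le_gapHi three_quarters_mem7 ⟨le_rfl, by linarith [b.epsHi_bounds.1]⟩).2 (by
            have : W.upEnd = b.parHi hκ h.seven_le_gapHi three_quarters_mem7 := rfl
            linarith [hc7.1])
        exact h4.trans_le (b.alphaHi_antitone' hκ h3.le)
    obtain ⟨y, hy, hyb⟩ := W.bent_general U.hl₀ U.hrA U.small hsc hαL hαH
    exact ⟨y, mem_closedBall.2 (by rw [dist_eq_norm]; exact hyb.trans U.gen_le), by rw [hy]⟩
  · -- upper spike: bent segment (`ψ ≥ 2 r_A`) or small arc (`ψ < 2 r_A`)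
    have hcore : s ∈ Icc (b.tcHi - b.epsHi / 8) (b.tcHi + b.epsHi / 8) := ⟨by linarith, by linarith [hs.2, cw₂.2]⟩
    have hα : b.alphaHi κ s ∈ Icc (3 / 8 : ℝ) (3 / 4) :=
      ⟨aw₂.1.trans ((b.strictAntiOn_alphaHi hκ).antitoneOn hcore cw₂ hs.2), by
        rw [← b.alphaHi_parHi hκ h.seven_le_gapHi three_quarters_mem7]
        exact (b.strictAntiOn_alphaHi hκ).antitoneOn (b.parHi_mem_core hκ h.seven_le_gapHi three_quarters_mem7) hcore h2⟩
    have hψ := psiHi_mem_of_alphaHi U.hl₀ hα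
    have hψ2 : b.psiHi κ lam₀ s ≤ ρ₂ := by
      rcases hs.2.eq_or_lt with h3 | h3
      · rw [h3, vw₂]
      · have := psiHi_lt_psiHi_of_lt U.hl₀ hκ hcore cw₂ h3 (by linarith [hα.2]); linarith
    rcases le_or_gt (2 * rA) (b.psiHi κ lam₀ s) with h3 | h3
    · left
      exact ⟨b.psiHi κ lam₀ s, ⟨by linarith [hψ.1, U.hl₀.1], hψ2⟩,
        by rw [W.bent_upperStraight U.hl₀ U.hrA U.hrA8 hcore hα ⟨h3, by linarith⟩]⟩
    · right
      obtain ⟨hy, hyb⟩ := W.bent_upperArc U.hl₀ U.hrA hcore hα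
      refine ⟨_, mem_closedBall.2 ?_, by rw [hy]⟩
      rw [dist_eq_norm]
      refine hyb.trans (le_trans ?_ U.arc_le)
      refine mul_le_mul_of_nonneg_left (mul_le_mul_of_nonneg_right ?_ (by positivity)) (mul_nonneg hκ.le hNF)
      rw [abs_of_nonneg (by linarith [hψ.1, U.hl₀.1])]; linarith

include hΨ in
/-- **THE OFF-WINDOW PROPERTY**: off the window the bent knot is a segment point with clock in
`[-1, 1/2] ∖ [-ρ₂, ρ₂]`, or a point whose `Ψ₁`-image is the north pole or at chart distance `≥ R₁`
from the target centre (granted the far-radius property of `R₁` for the target). [folklore] -/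
theorem off {R₁ : ℝ}
    (hfar : ∀ t ∈ Icc b.alo (b.alo + 1), t ∉ Ioo (b.strLo W.HU) (b.winHi W.HU WallRef.half_mem) →
      Htgt (circlePt t) = northPole ∨
        R₁ ≤ ‖psiN (Htgt (circlePt t)) - D.o'‖)
    {t : ℝ} (ht : t ∈ Ico b.alo (b.alo + 1)) (hts : t ∉ Icc (U.w₁ hρ4) (U.w₂ hρ4)) :
    (∃ ρ ∈ Icc (-1 : ℝ) (1 / 2), ρ ∉ Icc (-ρ₂) ρ₂ ∧
      Knot.curve (W.bent U.hl₀ U.hrA) t = ((psiN.symm (W.segO + ρ • W.segD) : 𝕊 3) : 𝔼 4)) ∨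
    ∃ x : 𝕊 3, Knot.curve (W.bent U.hl₀ U.hrA) t = (x : 𝔼 4) ∧
      (stageOne D.Ψ x = northPole ∨
        R₁ ≤ ‖psiN (stageOne D.Ψ x) - D.o'‖) := by
  have h := W.HU.cone.spike
  have hκ := h.κ_pos
  have hρ := U.ρ₂_pos
  have hc := cOne_mem U.hl₀
  obtain ⟨z1, z2, z3, z4, z5, z6⟩ := W.content_marks
  obtain ⟨m1, m2, m3, m3', m4, m5⟩ := b.str_marks W.HU WallRef.half_mem
  obtain ⟨cw₁, aw₁⟩ := W.lowPar_core (U.mem_two hρ4)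
  obtain ⟨cw₂, aw₂⟩ := W.upPar_core (U.mem_two hρ4)
  have vw₁ := (W.lowPar_spec (U.mem_two hρ4)).2
  have vw₂ := (W.upPar_spec (U.mem_two hρ4)).2
  obtain ⟨hjl, hjlv⟩ := b.juncLo_spec hκ h.seven_le_gapLo
  obtain ⟨hjh, hjhv⟩ := b.juncHi_spec hκ h.seven_le_gapHi
  have hjlc : b.juncLo hκ h.seven_le_gapLo ∈ Icc (b.tcLo - b.epsLo / 8) (b.tcLo + b.epsLo / 8) := ⟨by linarith [hjl.1, b.epsLo_bounds.1], hjl.2⟩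
  have hjhc : b.juncHi hκ h.seven_le_gapHi ∈ Icc (b.tcHi - b.epsHi / 8) (b.tcHi + b.epsHi / 8) := ⟨hjh.1, by linarith [hjh.2, b.epsHi_bounds.1]⟩
  have hsl := b.parLo_mem_core hκ h.seven_le_gapLo quarter_mem7
  have hsl' : b.strLo W.HU ∈ Icc (b.tcLo - b.epsLo / 8) (b.tcLo + b.epsLo / 8) := hsl
  have hwj := W.winHi_le_jHi
  rw [show W.jHi = b.juncHi hκ h.seven_le_gapHi from rfl] at hwj
  -- the reference-host alternative
  have viaHost : ∀ t' ∈ Icc b.alo (b.alo + 1), t' ∉ Ioo (b.strLo W.HU) (b.winHi W.HU WallRef.half_mem) →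
      W.bent U.hl₀ U.hrA (circlePt t) = W.host (circlePt t') →
      ∃ x : 𝕊 3, Knot.curve (W.bent U.hl₀ U.hrA) t = (x : 𝔼 4) ∧
        (stageOne D.Ψ x = northPole ∨
          R₁ ≤ ‖psiN (stageOne D.Ψ x) - D.o'‖) := by
    intro t' ht' hts' he
    refine ⟨W.host (circlePt t'), by rw [Knot.curve_apply, he], ?_⟩
    rw [hΨ]
    exact hfar t' ht' hts'
  simp only [w₁, w₂] at hts
  rw [Knot.curve_apply]
  by_cases hcs : t ∈ b.contentSet hκ h.seven_le_gapLo h.seven_le_gapHi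
  · -- content off the window: below `w₁` or above `w₂`
    have hcs' : b.juncLo hκ h.seven_le_gapLo ≤ t ∧ t ≤ b.juncHi hκ h.seven_le_gapHi := hcs
    rcases lt_or_ge t (W.lowPar (U.mem_two hρ4)) with h1 | h1
    · -- lower ray below the window: clock `< -ρ₂`
      left
      have hcore : t ∈ Icc (b.tcLo - b.epsLo / 8) (b.tcLo + b.epsLo / 8) := ⟨by linarith [hjlc.1], by linarith [cw₁.2]⟩
      have hα : b.alphaLo κ t ∈ Icc (3 / 8 : ℝ) (3 / 4) :=
        ⟨by rw [← hjlv]; exact (b.strictMonoOn_alphaLo hκ).monotoneOn hjlc hcore hcs'.1,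
          ((b.strictMonoOn_alphaLo hκ).monotoneOn hcore cw₁ h1.le).trans aw₁.2⟩
      have hψ := psiLo_mem_of_alphaLo U.hl₀ hα
      have hlt := psiLo_lt_psiLo_of_lt U.hl₀ hκ hcore cw₁ h1 (by linarith [aw₁.2])
      refine ⟨-b.psiLo κ lam₀ t, ⟨by linarith [hψ.2], by linarith [hψ.1, U.hl₀.1]⟩, fun hm ↦ by linarith [hm.1], ?_⟩
      rw [W.bent_lowerStraight U.hl₀ U.hrA hcore ⟨by linarith [hα.1], hα.2⟩]
    · have h2 : W.upPar (U.mem_two hρ4) < t := by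
        by_contra hle; push Not at hle; exact hts ⟨h1, hle⟩
      -- upper spike above the window: ray scalar `> ρ₂`
      have hcore : t ∈ Icc (b.tcHi - b.epsHi / 8) (b.tcHi + b.epsHi / 8) := ⟨by linarith [cw₂.1], by linarith [hjhc.2]⟩
      have hα : b.alphaHi κ t ∈ Icc (3 / 8 : ℝ) (3 / 4) :=
        ⟨by rw [← hjhv]; exact (b.strictAntiOn_alphaHi hκ).antitoneOn hcore hjhc hcs'.2,
          ((b.strictAntiOn_alphaHi hκ).antitoneOn cw₂ hcore h2.le).trans aw₂.2⟩
      have hψ := psiHi_mem_of_alphaHi U.hl₀ hα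
      have hlt := psiHi_lt_psiHi_of_lt U.hl₀ hκ cw₂ hcore h2 (by linarith [aw₂.2])
      rcases le_or_gt (b.psiHi κ lam₀ t) (1 / 2) with h3 | h3
      · left
        refine ⟨b.psiHi κ lam₀ t, ⟨by linarith [hψ.1, U.hl₀.1], h3⟩, fun hm ↦ by linarith [hm.2], ?_⟩
        rw [W.bent_upperStraight U.hl₀ U.hrA U.hrA8 hcore hα ⟨by linarith [U.rA_le], h3⟩]
      · right
        obtain ⟨t', ht', he⟩ := W.bent_spiral U.hl₀ U.hrA U.hrA8 hcore hα h3.le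
        rw [show W.jHi = b.juncHi hκ h.seven_le_gapHi from rfl] at ht'
        have hwc := b.winHi_mem_core W.HU WallRef.half_mem
        exact viaHost t' ⟨by linarith [ht'.1, hwc.1, b.core_marks.2.1, b.core_marks.1, b.epsLo_bounds.1],
          by linarith [ht'.2, hjhc.2, b.core_marks.2.2]⟩ (fun hm ↦ by linarith [hm.2, ht'.1]) he
  · -- off the content
    by_cases hstub : b.strLo W.HU ≤ t ∧ t < b.juncLo hκ h.seven_le_gapLo
    · -- the lower stub: clock in `[-1, -5/6)`
      left
      have hcore : t ∈ Icc (b.tcLo - b.epsLo / 8) (b.tcLo + b.epsLo / 8) := ⟨by linarith [hsl'.1, hstub.1], by linarith [hstub.2, hjlc.2]⟩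
      have hα1 : 1 / 4 ≤ b.alphaLo κ t := by
        rw [← b.alphaLo_parLo hκ h.seven_le_gapLo quarter_mem7]; exact (b.strictMonoOn_alphaLo hκ).monotoneOn hsl hcore hstub.1
      have hα2 : b.alphaLo κ t < 3 / 8 := b.alphaLo_lt_of_lt_juncLo hκ h.seven_le_gapLo hcore hstub.2
      have hv : b.psiLo κ lam₀ t = 1 - 4 / 3 * (b.alphaLo κ t - 1 / 4) := by
        rw [psiLo, spikeScalar_of_le_seven_sixteenths _ (by linarith)]
      refine ⟨-b.psiLo κ lam₀ t, ⟨by rw [hv]; linarith, by rw [hv]; linarith⟩, fun hm ↦ ?_, ?_⟩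
      · rw [hv] at hm; linarith [hm.1]
      · rw [W.bent_lowerStraight U.hl₀ U.hrA hcore ⟨hα1, by linarith⟩]
    · -- far from the straight range: the reference host, then the far radius
      right
      have hno : t ∉ Ioo (b.strLo W.HU) (b.winHi W.HU WallRef.half_mem) := fun hm ↦ by
        rcases lt_or_ge t (b.juncLo hκ h.seven_le_gapLo) with h1 | h1
        · exact hstub ⟨hm.1.le, h1⟩
        · exact hcs ⟨h1, by linarith [hm.2]⟩
      exact viaHost t ⟨ht.1, ht.2.le⟩ hno (W.bent_of_not_mem U.hl₀ U.hrA ht hcs)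


/-- **CONTENT PARAMETERS OFF THE WINDOW**: the bent knot is a segment point with clock in
`[-1, 1/2]`, or a reference host point on `[winHi, jHi]` (the spiral). [folklore] -/
theorem content_off_cases {t : ℝ} (hcs : t ∈ Icc W.jLo W.jHi) (hts : t ∉ Icc (U.w₁ hρ4) (U.w₂ hρ4)) :
    (∃ ρ ∈ Icc (-1 : ℝ) (1 / 2), W.bent U.hl₀ U.hrA (circlePt t) = psiN.symm (W.segO + ρ • W.segD)) ∨
    ∃ t' ∈ Icc (b.winHi W.HU WallRef.half_mem) W.jHi, W.bent U.hl₀ U.hrA (circlePt t) = W.host (circlePt t') := by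
  have h := W.HU.cone.spike
  have hκ := h.κ_pos
  have hρ := U.ρ₂_pos
  obtain ⟨cw₁, aw₁⟩ := W.lowPar_core (U.mem_two hρ4)
  obtain ⟨cw₂, aw₂⟩ := W.upPar_core (U.mem_two hρ4)
  have vw₁ := (W.lowPar_spec (U.mem_two hρ4)).2
  have vw₂ := (W.upPar_spec (U.mem_two hρ4)).2
  obtain ⟨hjl, hjlv⟩ := b.juncLo_spec hκ h.seven_le_gapLo
  obtain ⟨hjh, hjhv⟩ := b.juncHi_spec hκ h.seven_le_gapHi
  have hjlc : b.juncLo hκ h.seven_le_gapLo ∈ Icc (b.tcLo - b.epsLo / 8) (b.tcLo + b.epsLo / 8) := ⟨by linarith [hjl.1, b.epsLo_bounds.1], hjl.2⟩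
  have hjhc : b.juncHi hκ h.seven_le_gapHi ∈ Icc (b.tcHi - b.epsHi / 8) (b.tcHi + b.epsHi / 8) := ⟨hjh.1, by linarith [hjh.2, b.epsHi_bounds.1]⟩
  have hcs' : b.juncLo hκ h.seven_le_gapLo ≤ t ∧ t ≤ b.juncHi hκ h.seven_le_gapHi := hcs
  simp only [w₁, w₂] at hts
  rcases lt_or_ge t (W.lowPar (U.mem_two hρ4)) with h1 | h1
  · -- lower ray below the window
    left
    have hcore : t ∈ Icc (b.tcLo - b.epsLo / 8) (b.tcLo + b.epsLo / 8) := ⟨by linarith [hjlc.1], by linarith [cw₁.2]⟩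
    have hα : b.alphaLo κ t ∈ Icc (3 / 8 : ℝ) (3 / 4) :=
      ⟨by rw [← hjlv]; exact (b.strictMonoOn_alphaLo hκ).monotoneOn hjlc hcore hcs'.1,
        ((b.strictMonoOn_alphaLo hκ).monotoneOn hcore cw₁ h1.le).trans aw₁.2⟩
    have hψ := psiLo_mem_of_alphaLo U.hl₀ hα
    exact ⟨-b.psiLo κ lam₀ t, ⟨by linarith [hψ.2], by linarith [hψ.1, U.hl₀.1]⟩,
      W.bent_lowerStraight U.hl₀ U.hrA hcore ⟨by linarith [hα.1], hα.2⟩⟩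
  · have h2 : W.upPar (U.mem_two hρ4) < t := by
      by_contra hle; push Not at hle; exact hts ⟨h1, hle⟩
    have hcore : t ∈ Icc (b.tcHi - b.epsHi / 8) (b.tcHi + b.epsHi / 8) := ⟨by linarith [cw₂.1], by linarith [hjhc.2]⟩
    have hα : b.alphaHi κ t ∈ Icc (3 / 8 : ℝ) (3 / 4) :=
      ⟨by rw [← hjhv]; exact (b.strictAntiOn_alphaHi hκ).antitoneOn hcore hjhc hcs'.2,
        ((b.strictAntiOn_alphaHi hκ).antitoneOn cw₂ hcore h2.le).trans aw₂.2⟩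
    have hψ := psiHi_mem_of_alphaHi U.hl₀ hα
    have hlt := psiHi_lt_psiHi_of_lt U.hl₀ hκ cw₂ hcore h2 (by linarith [aw₂.2])
    rcases le_or_gt (b.psiHi κ lam₀ t) (1 / 2) with h3 | h3
    · left
      exact ⟨b.psiHi κ lam₀ t, ⟨by linarith [hψ.1, U.hl₀.1], h3⟩,
        W.bent_upperStraight U.hl₀ U.hrA U.hrA8 hcore hα ⟨by linarith [U.rA_le], h3⟩⟩
    · right
      exact W.bent_spiral U.hl₀ U.hrA U.hrA8 hcore hα h3.le

/-! ### The frame and the output knot of the first conjugation -/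

/-- **Window marks against the fundamental domain**: `alo < w₁`, `w₂ < alo + 1`, `c₁ < c₂`. [folklore] -/
theorem window_marks' : b.alo < U.w₁ hρ4 ∧ U.w₂ hρ4 < b.alo + 1 ∧ U.c₁ hρ4 < U.c₂ hρ4 := by
  obtain ⟨m1, m2, m3, m4, m5, m6⟩ := U.window_marks hρ4
  obtain ⟨z1, z2, z3, z4, z5, z6⟩ := W.content_marks
  have hcm := b.core_marks
  have hcc := b.coreLo_lt_coreHi
  have hε := b.epsLo_bounds.1
  have hε' := b.epsHi_bounds.1
  exact ⟨by linarith, by linarith, by linarith⟩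

include hDo hDd hDlo hDhi hΨ in
/-- **THE LOOP FRAME OF THE SEGMENT CONJUGATION**: the bent knot of `b` at the unit scale, framed
for the segment data `D` (window `[w₁, w₂]`, collars `[w₁, c₁]`, `[c₂, w₂]`), granted the
far-radius property of `R₁`. [folklore] -/
def frameOne {R₁ : ℝ}
    (hfar : ∀ t ∈ Icc b.alo (b.alo + 1), t ∉ Ioo (b.strLo W.HU) (b.winHi W.HU WallRef.half_mem) →
      Htgt (circlePt t) = northPole ∨
        R₁ ≤ ‖psiN (Htgt (circlePt t)) - D.o'‖) :
    D.Frame (-ρ₂) ρ₂ R₀ R₁ where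
  I₀ := Knot.curve (W.bent U.hl₀ U.hrA)
  a := b.alo
  ε₀ := min (U.w₁ hρ4 - b.alo) (b.alo + 1 - U.w₂ hρ4) / 2
  w₁ := U.w₁ hρ4
  c₁ := U.c₁ hρ4
  c₂ := U.c₂ hρ4
  w₂ := U.w₂ hρ4
  contDiff := (W.bent U.hl₀ U.hrA).contDiff_curve
  isRegularLoop := by
    rw [periodise_eq_of_periodic _ (W.bent U.hl₀ U.hrA).periodic_curve]; exact (W.bent U.hl₀ U.hrA).isRegularLoop_curve
  injOn := (W.bent U.hl₀ U.hrA).injOn_curve_Ico b.alo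
  ε₀_pos := by
    obtain ⟨h1, h2, -⟩ := U.window_marks' hρ4
    exact div_pos (lt_min (by linarith) (by linarith)) (by norm_num)
  seam t _ := (W.bent U.hl₀ U.hrA).periodic_curve t
  le_w₁ := by
    obtain ⟨h1, h2, -⟩ := U.window_marks' hρ4
    have := min_le_left (U.w₁ hρ4 - b.alo) (b.alo + 1 - U.w₂ hρ4)
    linarith
  w₁_lt := (U.window_marks hρ4).2.1
  c₁_lt := (U.window_marks' hρ4).2.2
  c₂_lt := (U.window_marks hρ4).2.2.2.2.1
  w₂_le := by
    obtain ⟨h1, h2, -⟩ := U.window_marks' hρ4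
    have := min_le_right (U.w₁ hρ4 - b.alo) (b.alo + 1 - U.w₂ hρ4)
    linarith
  collar s hs := by rw [hDo, hDd]; exact U.collar hρ4 hs
  inner s hs := by rw [hDo, hDd]; exact U.inner hρ4 hs
  off t ht hts := by rw [hDo, hDd, hDlo, hDhi]; exact U.off D hΨ hρ4 hfar ht hts

/-- **The base knot of the frame is the bent knot.** [folklore] -/
theorem baseKnot_frameOne {R₁ : ℝ}
    (hfar : ∀ t ∈ Icc b.alo (b.alo + 1), t ∉ Ioo (b.strLo W.HU) (b.winHi W.HU WallRef.half_mem) →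
      Htgt (circlePt t) = northPole ∨
        R₁ ≤ ‖psiN (Htgt (circlePt t)) - D.o'‖) :
    (U.frameOne D hDo hDd hDlo hDhi hΨ hρ4 hfar).baseKnot = W.bent U.hl₀ U.hrA := by
  set Fr := U.frameOne D hDo hDd hDlo hDhi hΨ hρ4 hfar
  apply DFunLike.coe_injective
  funext u
  obtain ⟨t, ht, htu⟩ := (W.bent U.hl₀ U.hrA).exists_mem_Ico_apply_circlePt_eq b.alo (x := W.bent U.hl₀ U.hrA u) ⟨u, rfl⟩
  -- `u = circlePt t'` for the parameter `t' ∈ [alo, alo + 1)` of `u` under the bent knot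
  have hu : circlePt t = u := (W.bent U.hl₀ U.hrA).injective htu
  rw [← hu]
  apply Subtype.ext
  rw [Fr.coe_baseKnot_circlePt (show t ∈ Ico Fr.a (Fr.a + 1) from ht)]
  show Knot.curve (W.bent U.hl₀ U.hrA) t = _
  rw [Knot.curve_apply]

include hDo hDd hDlo hDhi hΨ in
/-- **THE OUTPUT KNOT OF THE SEGMENT CONJUGATION.** [folklore] -/
def outOne {R₁ rc : ℝ}
    (hfar : ∀ t ∈ Icc b.alo (b.alo + 1), t ∉ Ioo (b.strLo W.HU) (b.winHi W.HU WallRef.half_mem) →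
      Htgt (circlePt t) = northPole ∨
        R₁ ≤ ‖psiN (Htgt (circlePt t)) - D.o'‖)
    (hS : D.Small (-ρ₂) ρ₂ R₀ R₁ rc) : Knot :=
  (U.frameOne D hDo hDd hDlo hDhi hΨ hρ4 hfar).outKnot hS

/-- **THE FIRST SEGMENT CONJUGATION**: the bent knot of `b` at the unit scale is isotopic to the
output knot `P₁`. [cite: HirschDT1976, Ch. 8 §1, Thm. 1.3] -/
theorem isIsotopic_bent_outOne {R₁ rc : ℝ}
    (hfar : ∀ t ∈ Icc b.alo (b.alo + 1), t ∉ Ioo (b.strLo W.HU) (b.winHi W.HU WallRef.half_mem) →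
      Htgt (circlePt t) = northPole ∨
        R₁ ≤ ‖psiN (Htgt (circlePt t)) - D.o'‖)
    (hS : D.Small (-ρ₂) ρ₂ R₀ R₁ rc) :
    (W.bent U.hl₀ U.hrA).IsIsotopic (U.outOne D hDo hDd hDlo hDhi hΨ hρ4 hfar hS) := by
  have h := (U.frameOne D hDo hDd hDlo hDhi hΨ hρ4 hfar).isIsotopic_baseKnot_outKnot hS
  rwa [U.baseKnot_frameOne D hDo hDd hDlo hDhi hΨ hρ4 hfar] at h

/-- **The output knot off the window**: `Ψ₁ (bent knot)`. [folklore] -/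
theorem outOne_circlePt_of_not_mem {R₁ rc : ℝ}
    (hfar : ∀ t ∈ Icc b.alo (b.alo + 1), t ∉ Ioo (b.strLo W.HU) (b.winHi W.HU WallRef.half_mem) →
      Htgt (circlePt t) = northPole ∨
        R₁ ≤ ‖psiN (Htgt (circlePt t)) - D.o'‖)
    (hS : D.Small (-ρ₂) ρ₂ R₀ R₁ rc)
    {t : ℝ} (ht : t ∈ Ico b.alo (b.alo + 1)) (hts : t ∉ Icc (U.w₁ hρ4) (U.w₂ hρ4)) :
    U.outOne D hDo hDd hDlo hDhi hΨ hρ4 hfar hS (circlePt t) =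
      stageOne D.Ψ (W.bent U.hl₀ U.hrA (circlePt t)) := by
  rw [outOne, (U.frameOne D hDo hDd hDlo hDhi hΨ hρ4 hfar).outKnot_circlePt_of_not_mem hS ht hts,
    U.baseKnot_frameOne D hDo hDd hDlo hDhi hΨ hρ4 hfar]

/-- **The output knot on the window**: `ψ⁻¹ (A (ψ (bent knot)))`, `A` the affine re-insertion of the
segment data. [folklore] -/
theorem coe_outOne_circlePt_of_mem {R₁ rc : ℝ}
    (hfar : ∀ t ∈ Icc b.alo (b.alo + 1), t ∉ Ioo (b.strLo W.HU) (b.winHi W.HU WallRef.half_mem) →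
      Htgt (circlePt t) = northPole ∨
        R₁ ≤ ‖psiN (Htgt (circlePt t)) - D.o'‖)
    (hS : D.Small (-ρ₂) ρ₂ R₀ R₁ rc)
    {s : ℝ} (hs : s ∈ Icc (U.w₁ hρ4) (U.w₂ hρ4)) :
    ((U.outOne D hDo hDd hDlo hDhi hΨ hρ4 hfar hS (circlePt s) : 𝕊 3) : 𝔼 4) =
      ((psiN.symm (D.A (psiN (W.bent U.hl₀ U.hrA (circlePt s)))) : 𝕊 3) : 𝔼 4) := by
  rw [outOne, (U.frameOne D hDo hDd hDlo hDhi hΨ hρ4 hfar).coe_outKnot_circlePt_of_mem hS hs, SegData.Frame.Y,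
    U.baseKnot_frameOne D hDo hDd hDlo hDhi hΨ hρ4 hfar]

include hDo hDd hDlo hDhi hΨ in
/-- **The bent knot avoids the north pole on the window.** [folklore] -/
theorem bent_ne_northPole_of_mem {R₁ : ℝ}
    (hfar : ∀ t ∈ Icc b.alo (b.alo + 1), t ∉ Ioo (b.strLo W.HU) (b.winHi W.HU WallRef.half_mem) →
      Htgt (circlePt t) = northPole ∨
        R₁ ≤ ‖psiN (Htgt (circlePt t)) - D.o'‖)
    {s : ℝ} (hs : s ∈ Icc (U.w₁ hρ4) (U.w₂ hρ4)) : W.bent U.hl₀ U.hrA (circlePt s) ≠ northPole := by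
  have h := (U.frameOne D hDo hDd hDlo hDhi hΨ hρ4 hfar).baseKnot_ne_northPole hs
  rwa [U.baseKnot_frameOne D hDo hDd hDlo hDhi hΨ hρ4 hfar] at h

/-! ### Thresholds -/

omit U hρ4 in
/-- **Smallness persists for smaller unit radii.** [folklore] -/
theorem _root_.Literature.Topology.FourManifolds.SegmentConj.SegData.Small.mono_R₀ {D : SegData} {ρ₁ ρ₂' R₀' R₀'' R₁ rc : ℝ}
    (hS : D.Small ρ₁ ρ₂' R₀' R₁ rc) (hR : 0 < R₀'') (hle : R₀'' ≤ R₀') : D.Small ρ₁ ρ₂' R₀'' R₁ rc where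
  rc_pos := hS.rc_pos
  ball_subset := hS.ball_subset
  fderiv_le := hS.fderiv_le
  ρ₁_le := hS.ρ₁_le
  ρ₁_neg := hS.ρ₁_neg
  ρ₂_pos := hS.ρ₂_pos
  ρ₂_le := hS.ρ₂_le
  seg_ball := hS.seg_ball
  R₀_pos := hR
  R₀_le := by linarith [hS.R₀_le]
  unit_seg := by
    have h := hS.unit_seg
    have hN : 0 ≤ ‖((D.L : (𝔼 3) ≃L[ℝ] 𝔼 3) : (𝔼 3) →L[ℝ] 𝔼 3)‖ := norm_nonneg _
    nlinarith
  R₁_pos := hS.R₁_pos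
  seg_far := hS.seg_far
  unit_far := by
    have h := hS.unit_far
    have hN : 0 ≤ ‖((D.L : (𝔼 3) ≃L[ℝ] 𝔼 3) : (𝔼 3) →L[ℝ] 𝔼 3)‖ := norm_nonneg _
    nlinarith


omit U hρ4 in
/-- **EXISTENCE OF THE THRESHOLDS** from a far radius: a bound `ρmax` such that every window clock
`ρ₂ ≤ ρmax` admits unit radii (all smaller ones as well) satisfying the smallness conditions.
[folklore] -/
theorem exists_thresholds {R₁ : ℝ} (hR₁ : 0 < R₁) :
    ∃ ρmax > 0, ∀ ρ₂', 0 < ρ₂' → ρ₂' ≤ ρmax → ∃ R₀' > 0, ∃ rc, ∀ R₀'', 0 < R₀'' → R₀'' ≤ R₀' →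
      D.Small (-ρ₂') ρ₂' R₀'' R₁ rc := by
  obtain ⟨ρmax, hρmax, hsm⟩ := D.exists_small hR₁
  refine ⟨ρmax, hρmax, fun ρ₂' h1 h2 ↦ ?_⟩
  obtain ⟨R₀', rc, hS⟩ := hsm (-ρ₂') ρ₂' (by linarith) (by linarith) h1 h2
  exact ⟨R₀', hS.R₀_pos, rc, fun R₀'' h3 h4 ↦ hS.mono_R₀ h3 h4⟩

end UnitScale

end WallRef

end FrameOne

end BandData

end Literature.Topology.FourManifolds
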